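import Literature.AlgebraicGeometry.Frobenioids.BaseCategoryTheoreticityExamples
import Literature.AlgebraicGeometry.Frobenioids.DivisorMonoidCategoryTheoreticityDefs
import HarnessLib

/-!
# Frobenioids I, §4: Remark 4.12.1 (Example 3.10 with a residually finite group)

Mochizuki, *The geometry of Frobenioids I: the general theory*, Kyushu J. Math. **62** (2008)
293–400, kurims text p. 95 [cite: MochizukiFrdI2008, Rem. 4.12.1 p.95].

"One verifies immediately that if one takes the group `G` of Example 3.10 to be residually finite, then
the Frobenioid of Example 3.10 is of rationally standard and unit-trivial type [but not of group-like
type] over a Frobenius-slim base category [which is not Div-slim — cf. Remark 4.11.2]. In particular,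
one may apply Corollary 4.12 to the self-equivalence of categories of Example 3.10. On the other hand,
since this self-equivalence fails to preserve base-identity endomorphisms of Frobenius type, it follows
that it is not possible to replace the `F_{0_{D_i}}` in the diagram of Corollary 4.12 by `D_i`."

Typed over the vocabulary of seat abc-iut-L1-t3 (consumed by name, not re-declared): Example 3.10's
operations `Ex310.data G` / base `Ex310.D G` / self-equivalence `Ex310.twist`
(`BaseCategoryTheoreticityExamples.lean`), Frobenius-slimness `IsFrobeniusSlim` and residual finiteness
`IsResiduallyFiniteGroup` (Def. 3.1 (i), Rem. 3.1.2; `BaseCategoryTheoreticityDefs.lean`), rationally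
standard type `PreFrobenioidData.IsOfRationallyStandardType` over its §4 parameters `RSParams` and
Div-slimness `PreFrobenioidData.IsDivSlim` (Def. 4.5 (iii)(iv); `DivisorMonoidCategoryTheoreticityDefs.lean`),
unit-trivial / group-like type (`PreFrobenioidData.lean`).  SCHEMA LABEL: the rationally-standard
clause is stated over the data parameter `R : RSParams` of t3's Def. 4.5 (iii) (its birationalisation /
unit-trivialisation data), which becomes a closed instance when those constructions land.  The last
sentence of the remark is the non-preservation clause already typed in `Ex310.claims` (t3) together with
Cor. 4.12 (`CategoryTheoreticityFacts.lean`, t3); it is quoted, not re-typed.  Named statement (explicit-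
model verification genre); the group-theoretic kernel — Rem. 3.1.2, "`𝔽 → G` factors through `N_{≥1}`
for residually finite `G`" — is t3's PROVED `factors_degHom_of_isResiduallyFiniteGroup`, and the
triviality of the action behind "not Div-slim" is `Rmk4112.pull_eq_self` (`DivSlimExample.lean`).
No statement of the paper is strengthened; nothing here bears on [IUTchI–IV].
-/

namespace Literature.AlgebraicGeometry.Frobenioids

open CategoryTheory

namespace Rmk4121

variable (G : Type) [Group G]

/-- FrdI Rem. 4.12.1 (p. 95), typed (schema over the §4 parameters `R` of Def. 4.5 (iii)): for `G`
residually finite, the Frobenioid `C = SingleObj (G × 𝔽) → D = SingleObj G` of Example 3.10 is of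
rationally standard and unit-trivial type, not of group-like type, and its base `D` is Frobenius-slim
but not Div-slim (relative to its monoid `Φ ≡ ℤ_{≥0}`) — so that Cor. 4.12 applies to the
self-equivalence `Ex310.twist` while, by the last clause of `Ex310.claims`, "`F_{0_{D_i}}`" cannot be
replaced by "`D_i`" there. [cite: MochizukiFrdI2008, Rem. 4.12.1 p.95] -/
def Statement (R : (Ex310.data G).RSParams) : Prop :=
  IsResiduallyFiniteGroup G →
    PreFrobenioidData.IsOfRationallyStandardType (Ex310.data G) R ∧
      (Ex310.data G).IsOfUnitTrivialType ∧ ¬ (Ex310.data G).IsOfGroupLikeType ∧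
      IsFrobeniusSlim (Ex310.D G) ∧ ¬ (Ex310.data G).IsDivSlim

end Rmk4121

end Literature.AlgebraicGeometry.Frobenioids
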